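import Literature.Claims.NS.ClayVariants
import Literature.Analysis.FluidPDE.LerayHopf
import Literature.Analysis.FluidPDE.NSLerayHopfSereginEnergyProofs
import HarnessLib

/-!
# Claim skeleton (D-0090 NS-CLAIMS, C74): Mitrović, arXiv:2411.02568v1 (2024) — «Viscosity under infinite acceleration
# assumptions and Navier Stokes equations» (pseudo-parabolic approximation)

Typed skeleton of D. Mitrović, *Viscosity under infinite acceleration assumptions and Navier Stokes equations*,
arXiv:2411.02568 **v1** [math.AP], 4 Nov 2024, 11 pp. — the TEXT OF RECORD for C74 (lead ruling 2026-08-26 16:10Z: the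
unconditional text), bib `Mitrovic2024`; TeX + PDF + pages + renders held in `run/shared/lean/pub/ns-claims/sources/Mitrovic2024/`
(LOCATORS.md by ns-claims-lit-2; PAGEMAP-v1 by ns-claims-lit-1 g5). ONE arXiv identifier carries THREE successive manuscripts
(13 versions): v8 (2025-01-02) WITHDRAWN «The paper contains an uncorrectable mistake in the formula between (30) and (31)…»
(v7 numbering, a different argument), v10 WITHDRAWN «mistake in the application of the fixed point theorem», v13 (2026-02-26,
current) CONDITIONAL: «All previous versions are wrong. New assumptions were added …» — lineage recorded in CARD §1, not typed.
UNREFEREED CLAIM under adjudication — NOTHING in this file asserts a step: the paper's statements are `def … : Prop`; the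
theorems are kernel relations (composition, Clay link, two bookkeeping facts). `p. N` = v1 PDF page; `(n)` = v1 equation
numbers; `l. N` = v1 TeX lines (`v1-2024-11-04-N-S-pseudopar6.tex`).

## The claimed statement (verbatim)

Abstract (l. 255–262, p. 1): "… given smooth initial data, solutions to a variant of these approximate equations remain
uniformly bounded. Furthermore, we show that these bounded solutions converge to the Leray solution of the Navier-Stokes
equations. Our results imply global existence and smoothness for the associated Cauchy problem, thus resolving the regularity
question for the Navier-Stokes equations." §1 l. 308–312: "… settling the question of existence and uniqueness of smooth
solutions to the Navier-Stokes equations." l. 554 p. 8: "The following theorem is actually the solution to the Millennium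
Prize Problem." **Theorem 4 [p. 8; l. 556–558]**: "The family of solutions `(u_ε)` to (12) for `α(ε) = ε^{−1/4}` converges
along a subsequence toward the unique, smooth solution of the Navier-Stokes equations." — resting on **Theorem 3 [p. 8;
l. 520–522]** "If `α(ε) = ε^{1/4}` [sic; the proof and Theorem 4 use `ε^{−1/4}`] then the solution `u` to (13) constructed in
Theorem 1 is bounded independently of `ε` and `t > 0`", Theorem 1 [p. 5] (a distributional solution of (13) exists).
SETTING (§3 p. 4–5): `ℝ³`, `ν = 1`, `f ≡ 0`; data (9)–(10) `u₀ ∈ 𝒟(ℝ³)` (= `C_c^∞`), `div u₀ = 0`; (12)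
`∂ₜu − ∇T_{α(ε)}(ℙ(u⊗u)) = Δu + ε∂ₜΔu` (clipping `T_α` coordinatewise at `±α`, `ℙ` Leray projector); rescaling (2)
`t ↦ ε²t, x ↦ εx` gives (13) `∂ₜu + ε div T_{α(ε)}(ℙ(u⊗u)) = Δu + ∂ₜΔu`; mild form (20)
`u(t) = e^{−t}u₀(ε·) + ∫₀ᵗ e^{−(t−s)}(I−Δ)⁻¹u(s)ds + ε∫₀ᵗ e^{−(t−s)}(I−Δ)⁻¹∇T_{α(ε)}(ℙ(u⊗u))(s)ds`.

RENDERING. «the unique, smooth solution of the Navier-Stokes equations» from `u₀` for all `t ≥ 0` (T arbitrary in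
(28)–(31)), with the energy bounds (29)–(30) = a Clay-(A)-sense solution at `ν = 1`: `ClayVariants.clayR3.Solvable 1 0 u₀`
(smooth `u, p` on `ℝ³ × [0,∞)`, (1)–(3), bounded energy (7)). `ClaimedTheorem` takes the theorems' data class `𝒟(ℝ³)`
(`IsDatum`: smooth, compactly supported, divergence free); `ClaimedTheoremAbstract` the abstract's/§3's "smooth rapidly
decreasing initial data" = Clay's class (4) (`HasRapidSpatialDecay`), which at `ν = 1` IS Clay (A)
(`claimedAbstract_iff_clayA`, proved via the tree's `clayR3_regularityAt_iff`); `claimed_of_abstract` (proved: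
`C_c^∞ ⊂ (4)`). The proof architecture is typed at the grain at which Theorems 3–4 pass information — the sup-norm functions
`f_ε(t) = ‖u^ε(t)‖_∞` of the solutions of (13) — with the field-level inputs (Theorem 1; Young's inequality from (20),(25);
the compactness passage (28)–(33)) bundled as the hypothesis-structure `Route` (what Theorem 4 USES), and the scalar inference
(26) ⇒ (27) as its own Step.

## Clay delta (reference `Literature.Claims.NS.ClayVariants`)

Nearest Clay statement (A). Δ1 `ℝ³` =; Δ2 `ν = 1` (= by scaling, `clayR3_regularityAt_iff`); Δ3 `f ≡ 0` =; **Δ4 data**: the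
theorems take `u₀ ∈ 𝒟(ℝ³)` — a proper SUBCLASS of (4); the abstract's sentence takes (4): `ClaimedTheoremAbstract ↔ (A)`,
`ClaimedTheorem` = (A) restricted to compactly supported data; Δ5/Δ6 conclusion = smooth bounded-energy solution (= (A)'s,
pressure by the usual Riesz formula l. 633); Δ7 all `t` =. `clay_of_claimedAbstract` PROVED; no `clay_of_claimed` for the
`𝒟(ℝ³)` rendering (it is (A) on a subclass).

## ORDERED STEP INDEX (dependency order = print order; the order `claim_of_steps` consumes them)

* Step 1 = `RouteExists` — the architecture Theorem 4 uses, as a hypothesis-structure `Route u₀ f` over the sup-norm family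
  `f : ε ↦ (t ↦ ‖u^ε(t)‖_∞)`: Theorem 1 (p. 5–7, existence for (13)); Theorem 3's first half (p. 8, l. 523–548: (20), the
  `L¹` kernels (25) with norms `C₁, C₂`, Young ⇒ (26)); Theorem 4's body (p. 8–10, l. 559–636: rescaling l. 560
  `u_ε(t,x) = u(t/ε², x/ε)` "remains bounded independently of `ε` … the same holds for `u_ε`"; energy (28)–(30), (31),
  Aubin–Lions, "By the construction, the subsequence `(u_ε)` is bounded and thus the function `u` as well" l. 607, passage to
  (33)). NOT a refutation target at this grain (its `limit` field is an implication whose premise is Step 2's output).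
* Step 2 = `Gronwall2627` (Theorem 3 proof p. 8, l. 549–552: "From here, by the Gronwall inequality, we get (27)
  `‖u(t,·)‖_∞ ≤ (‖u₀(ε·)‖_∞ + ε^{3/4}C₂)e^{C₁(1−e^{−t})} ≤ (‖u₀(ε·)‖_∞ + C₂)e^{C₁}`" from (26)
  `‖u(t,·)‖_∞ ≤ ‖u₀‖_∞ + C₁∫₀ᵗe^{−(t−s)}‖u(s,·)‖_∞ds + ε^{3/4}C₂(1−e^{−t})`). The cell's PRE-REGISTERED LOCATOR (CARD §4,
  STATUS `PREDICTED C74`): the memory kernel `C₁e^{−(t−s)}` is not a Gronwall weight — `f(t) = a(1+t)` satisfies (26) with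
  equality when `C₁ = 1` (print: `C₁ = ‖𝓕⁻¹((1+|ξ|²)⁻¹)‖_{L¹}`, the `L¹` norm of the positive Bessel kernel, i.e. its symbol
  at `0`) and exceeds `(a + C₂)e^{C₁}` for large `t`; recorded for the refuter, NOT asserted.
* Step 3 = `Rescale560` (Theorem 4 proof l. 559–560): a bound on `f` uniform over `t ∈ [0,∞)` transfers to the rescaled
  family `t ↦ f(t/ε²)` uniformly in `ε` — TRUE bookkeeping, PROVED (`rescale560_holds`); `rescale_needs_uniformity` (PROVED)
  records that a horizon-dependent bound does not transfer (the horizon `T/ε² → ∞`), i.e. the `t`-uniformity claimed in (27)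
  is exactly what l. 560 consumes.
* Step 4 = `BoundedLerayHopfSmooth` (l. 636: "Since `u` is bounded, it must be smooth and unique (see [rieusset, serrin])";
  pressure `p = ΣR_iR_j u_iu_j` l. 633): a bounded global Leray–Hopf solution from a `𝒟(ℝ³)` datum is a Clay-(A)-sense solution.
  TRUE-type (Serrin / Ladyzhenskaya–Prodi–Serrin class `L^∞_tL^∞_x`), classical; consumed.
* HEADLINE = `ClaimedTheorem` (Theorem 4 for `𝒟(ℝ³)` data) · `ClaimedTheoremAbstract` (abstract, class (4); ↔ (A)).

COMPOSITION: `claim_of_steps : RouteExists → Gronwall2627 → BoundedLerayHopfSmooth → ClaimedTheorem` PROVED (Step 3 is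
folded into `Route.limit`, which asks for the `t`-uniform bound). The paper's logic composes AS PRINTED; the pre-registered
locator is Step 2 (adjudicated by refuter/referee, not here).

WHAT THIS IS NOT: not a claim about NS regularity or blow-up; not a claim about any author beyond the typed locator.
-/

noncomputable section

open Set Function Filter MeasureTheory
open scoped ContDiff Topology

namespace Literature.Claims.NS.Mitrovic2024

open Literature.Analysis.FluidPDE

/-! ### Vocabulary -/

/-- Data (9)–(10) p. 4–5 (l. 367–375): `u₀ ∈ 𝒟(ℝ³)` — smooth, COMPACTLY supported — with `div u₀ = 0`.
[cite: Mitrovic2024, (9)–(10) p.4–5] -/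
def IsDatum (u₀ : EuclideanSpace ℝ (Fin 3) → EuclideanSpace ℝ (Fin 3)) : Prop :=
  ContDiff ℝ ∞ u₀ ∧ HasCompactSupport u₀ ∧ NSWave0.IsDivFree u₀

/-- `‖u₀‖_∞` (the constant in (26)–(27); `‖u₀(ε·)‖_∞ = ‖u₀‖_∞`, l. 545). [cite: Mitrovic2024, (26) p.8] -/
def supNorm (u₀ : EuclideanSpace ℝ (Fin 3) → EuclideanSpace ℝ (Fin 3)) : ℝ :=
  ⨆ x, ‖u₀ x‖

/-- Display (26) p. 8 (l. 540–548) for a sup-norm function `f(t) = ‖u(t,·)‖_∞` of a solution of (13):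
`f(t) ≤ a + C₁∫₀ᵗ e^{−(t−s)} f(s) ds + ε^{3/4}C₂(1 − e^{−t})` for `t ≥ 0` (`a = ‖u₀‖_∞`; `C₁, C₂` the `L¹` norms (25) of
the kernels of `(I−Δ)⁻¹` and `(I−Δ)⁻¹∇`). [cite: Mitrovic2024, (26) p.8] -/
def Bound26 (ε C₁ C₂ a : ℝ) (f : ℝ → ℝ) : Prop :=
  ∀ t : ℝ, 0 ≤ t →
    f t ≤ a + C₁ * (∫ s in (0 : ℝ)..t, Real.exp (-(t - s)) * f s) + ε ^ (3 / 4 : ℝ) * C₂ * (1 - Real.exp (-t))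

/-- Display (27) p. 8 (l. 549–552), first inequality: `f(t) ≤ (a + ε^{3/4}C₂) e^{C₁(1 − e^{−t})}` for `t ≥ 0` — a bound
UNIFORM in `t` (`≤ (a + C₂)e^{C₁}` for `ε ≤ 1`, `bound27_uniform`), which is Theorem 3's conclusion "bounded independently of
`ε` and `t > 0`". [cite: Mitrovic2024, (27) p.8] -/
def Bound27 (ε C₁ C₂ a : ℝ) (f : ℝ → ℝ) : Prop :=
  ∀ t : ℝ, 0 ≤ t → f t ≤ (a + ε ^ (3 / 4 : ℝ) * C₂) * Real.exp (C₁ * (1 - Real.exp (-t)))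

/-- **What Theorem 4 USES of Theorems 1–3 and of its own body**, for a datum `u₀`, over the family
`f ε = (t ↦ ‖u^ε(t,·)‖_∞)` of sup norms of the solutions `u^ε` of (13) (Theorem 1 p. 5–7): each `f ε` (`0 < ε ≤ 1`) is
continuous and nonnegative on `[0,∞)`; (26) holds with `a = ‖u₀‖_∞` and constants `C₁ > 0`, `C₂ ≥ 0` independent of
`ε, t` (Theorem 3 proof l. 523–548: (20), (25), Young); and the LIMIT PASSAGE of Theorem 4 (l. 559–636): IF the family is
bounded uniformly in `ε ∈ (0,1]` and `t ≥ 0` (so that the rescaled `u_ε(t,x) = u^ε(t/ε², x/ε)`, l. 560, are uniformly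
bounded on every `[0,T] × ℝ³`), THEN along a subsequence `u_ε → u`, a global Leray–Hopf solution from `u₀` bounded by the
same constant ((28)–(33), Aubin–Lions, l. 607 "the subsequence `(u_ε)` is bounded and thus the function `u` as well").
A hypothesis-structure: it records the printed architecture, it is not itself a refutation target.
[cite: Mitrovic2024, Theorem 1 p.5, (20)/(25)/(26) p.7–8, Theorem 4 proof p.8–10] -/
structure Route (u₀ : EuclideanSpace ℝ (Fin 3) → EuclideanSpace ℝ (Fin 3)) (f : ℝ → ℝ → ℝ) : Prop where
  /-- `t ↦ ‖u^ε(t)‖_∞` is continuous on `[0,∞)` -/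
  cont : ∀ ε ∈ Ioc (0 : ℝ) 1, ContinuousOn (f ε) (Ici 0)
  /-- and nonnegative -/
  nonneg : ∀ ε ∈ Ioc (0 : ℝ) 1, ∀ t : ℝ, 0 ≤ t → 0 ≤ f ε t
  /-- (26), with `ε`-, `t`-independent constants (Theorem 3 proof, first half) -/
  young26 : ∃ C₁ C₂ : ℝ, 0 < C₁ ∧ 0 ≤ C₂ ∧ ∀ ε ∈ Ioc (0 : ℝ) 1, Bound26 ε C₁ C₂ (supNorm u₀) (f ε)
  /-- Theorem 4's limit passage: a bound uniform in `ε ∈ (0,1]`, `t ≥ 0` yields a bounded global Leray–Hopf limit -/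
  limit : (∃ M : ℝ, ∀ ε ∈ Ioc (0 : ℝ) 1, ∀ t : ℝ, 0 ≤ t → f ε t ≤ M) →
    ∃ u : ℝ → EuclideanSpace ℝ (Fin 3) → EuclideanSpace ℝ (Fin 3),
      (∀ T : ℝ, 0 < T → IsLerayHopfOn T 1 0 u₀ u) ∧ ∃ M : ℝ, ∀ t : ℝ, 0 ≤ t → ∀ x, ‖u t x‖ ≤ M

/-! ### The claimed theorem (Theorem 4 p. 8; abstract p. 1) -/

/-- **HEADLINE (Theorem 4 p. 8 with l. 636 and §1 l. 308–312), for the theorems' data class `𝒟(ℝ³)`**: every smooth,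
compactly supported, divergence-free `u₀` has a (unique) smooth solution of Navier–Stokes (`ν = 1`, `f ≡ 0`) on
`ℝ³ × [0,∞)` with bounded energy — a Clay-(A)-sense solution at `ν = 1`. [claim: Mitrovic2024, status: disputed] -/
def ClaimedTheorem : Prop :=
  ∀ u₀ : EuclideanSpace ℝ (Fin 3) → EuclideanSpace ℝ (Fin 3), IsDatum u₀ → ClayVariants.clayR3.Solvable 1 0 u₀

/-- **HEADLINE as the abstract states it (l. 255–262; §3 l. 367 "smooth rapidly decreasing initial data")**: the same for
every smooth divergence-free datum of Clay's class (4) (`HasRapidSpatialDecay`) — i.e. `clayR3.RegularityAt 1`.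
[claim: Mitrovic2024, status: disputed] -/
def ClaimedTheoremAbstract : Prop :=
  ∀ u₀ : EuclideanSpace ℝ (Fin 3) → EuclideanSpace ℝ (Fin 3), ContDiff ℝ ∞ u₀ → NSWave0.IsDivFree u₀ →
    HasRapidSpatialDecay u₀ → ClayVariants.clayR3.Solvable 1 0 u₀

/-- The abstract's sentence IS Clay (A): (A) at `ν = 1` ⇔ (A) (tree `clayR3_regularityAt_iff`).
[cite: FeffermanClay2006, statement (A), CMI offprint p. 2] -/
theorem claimedAbstract_iff_clayA : ClaimedTheoremAbstract ↔ ClayVariants.clayR3.Regularity :=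
  (Iff.rfl : ClaimedTheoremAbstract ↔ ClayVariants.clayR3.RegularityAt 1).trans
    (ClayVariants.clayR3_regularityAt_iff one_pos)

/-- **Clay link**: the abstract's claimed statement implies Clay (A). [cite: FeffermanClay2006, statement (A), CMI offprint p. 2] -/
theorem clay_of_claimedAbstract (h : ClaimedTheoremAbstract) : ClayVariants.clayR3.Regularity :=
  claimedAbstract_iff_clayA.1 h

/-- The abstract's class contains the theorems' class: `C_c^∞ ⊂ (4)` (tree `HasRapidSpatialDecay.of_hasCompactSupport`).
[cite: Mitrovic2024, (9) p.4 and abstract p.1] -/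
theorem claimed_of_abstract (h : ClaimedTheoremAbstract) : ClaimedTheorem := fun u₀ hu₀ =>
  h u₀ hu₀.1 hu₀.2.2 (HasRapidSpatialDecay.of_hasCompactSupport hu₀.1 hu₀.2.1)

/-! ### The paper's steps (no assertion) -/

/-- **Step 1 — the route exists (Theorem 1 p. 5–7; Theorem 3 proof first half p. 8, (20), (25), (26); Theorem 4 proof
p. 8–10, (28)–(33))**: for every datum there is a family of sup-norm functions with the properties Theorem 4 uses
(`Route`). Hypothesis-structure of the printed architecture; see `Route`. [claim: Mitrovic2024, status: disputed] -/
def RouteExists : Prop :=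
  ∀ u₀ : EuclideanSpace ℝ (Fin 3) → EuclideanSpace ℝ (Fin 3), IsDatum u₀ → ∃ f : ℝ → ℝ → ℝ, Route u₀ f

/-- **Step 2 — (26) ⇒ (27) "by the Gronwall inequality" (Theorem 3 proof p. 8, l. 549–552)** — the cell's pre-registered
locator. TYPED as the scalar inference it is: for constants `0 < ε ≤ 1`, `C₁ > 0`, `C₂ ≥ 0`, `a ≥ 0` and a continuous
nonnegative `f` on `[0,∞)`, (26) implies (27). (The integral in (26) carries the MEMORY kernel `e^{−(t−s)}`; Gronwall's
lemma bounds `f ≤ a·exp(∫₀ᵗβ)` for `f(t) ≤ a + ∫₀ᵗ β(s)f(s)ds` with a weight `β(s)` not depending on `t`.)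
[claim: Mitrovic2024, status: disputed] -/
def Gronwall2627 : Prop :=
  ∀ (ε C₁ C₂ a : ℝ) (f : ℝ → ℝ), 0 < ε → ε ≤ 1 → 0 < C₁ → 0 ≤ C₂ → 0 ≤ a →
    ContinuousOn f (Ici 0) → (∀ t : ℝ, 0 ≤ t → 0 ≤ f t) → Bound26 ε C₁ C₂ a f → Bound27 ε C₁ C₂ a f

/-- **Step 3 — the rescaling (Theorem 4 proof l. 559–560)**: "if `u` is a solution to (13) then `u_ε := u(t/ε², x/ε)` is
the solution to (12). Since the solution `u` to (13) remains bounded independently of `ε` … the same holds for `u_ε`":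
a bound uniform over `t ∈ [0,∞)` transfers to `t ↦ f(t/ε²)` for every `ε > 0`. (TRUE — PROVED, `rescale560_holds`.)
[claim: Mitrovic2024, status: disputed] -/
def Rescale560 : Prop :=
  ∀ (f : ℝ → ℝ) (M : ℝ), (∀ t : ℝ, 0 ≤ t → f t ≤ M) → ∀ ε : ℝ, 0 < ε → ∀ t : ℝ, 0 ≤ t → f (t / ε ^ 2) ≤ M

/-- **Step 4 — bounded ⇒ smooth and unique (l. 633–636)**: "By taking as usual `p = Σ R_iR_j u_iu_j` we see that `u`
and `p` solve the standard Navier-Stokes equations. Since `u` is bounded, it must be smooth and unique (see [rieusset,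
serrin])." TYPED: a global Leray–Hopf solution (`ν = 1`, `f ≡ 0`) from a `𝒟(ℝ³)` datum which is bounded on `[0,∞) × ℝ³`
is (with its pressure) a Clay-(A)-sense solution. (TRUE-type: the Serrin class `L^∞_tL^∞_x`; classical.)
[claim: Mitrovic2024, status: disputed] -/
def BoundedLerayHopfSmooth : Prop :=
  ∀ u₀ : EuclideanSpace ℝ (Fin 3) → EuclideanSpace ℝ (Fin 3), IsDatum u₀ →
    ∀ u : ℝ → EuclideanSpace ℝ (Fin 3) → EuclideanSpace ℝ (Fin 3),
      (∀ T : ℝ, 0 < T → IsLerayHopfOn T 1 0 u₀ u) → (∃ M : ℝ, ∀ t : ℝ, 0 ≤ t → ∀ x, ‖u t x‖ ≤ M) →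
      ClayVariants.clayR3.Solvable 1 0 u₀

/-! ### Kernel relations -/

/-- (27)'s second inequality: for `0 < ε ≤ 1`, `C₂ ≥ 0`, the bound (27) is uniform in `t`:
`(a + ε^{3/4}C₂)e^{C₁(1−e^{−t})} ≤ (a + C₂)e^{C₁}` (`C₁ ≥ 0`, `a ≥ 0`). [cite: Mitrovic2024, (27) p.8] -/
theorem bound27_uniform {ε C₁ C₂ a : ℝ} {f : ℝ → ℝ} (hε : 0 < ε) (hε1 : ε ≤ 1) (hC₁ : 0 ≤ C₁) (hC₂ : 0 ≤ C₂)
    (ha : 0 ≤ a) (h : Bound27 ε C₁ C₂ a f) : ∀ t : ℝ, 0 ≤ t → f t ≤ (a + C₂) * Real.exp C₁ := by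
  intro t ht
  have h1 := h t ht
  have hε34 : ε ^ (3 / 4 : ℝ) ≤ 1 := Real.rpow_le_one hε.le hε1 (by norm_num)
  have hA : a + ε ^ (3 / 4 : ℝ) * C₂ ≤ a + C₂ := by nlinarith
  have hB : Real.exp (C₁ * (1 - Real.exp (-t))) ≤ Real.exp C₁ := by
    apply Real.exp_le_exp.2
    have : 0 < Real.exp (-t) := Real.exp_pos _
    nlinarith
  have hA0 : 0 ≤ a + ε ^ (3 / 4 : ℝ) * C₂ := by positivity
  calc f t ≤ (a + ε ^ (3 / 4 : ℝ) * C₂) * Real.exp (C₁ * (1 - Real.exp (-t))) := h1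
    _ ≤ (a + C₂) * Real.exp C₁ :=
        mul_le_mul hA hB (Real.exp_pos _).le (by positivity)

/-- Step 3 is a triviality once the bound is uniform in `t ∈ [0,∞)`. [cite: Mitrovic2024, Theorem 4 proof p.8 (l.560)] -/
theorem rescale560_holds : Rescale560 := by
  intro f M hf ε hε t ht
  exact hf (t / ε ^ 2) (by positivity)

/-- Why the `t`-uniformity in (27) is load-bearing for l. 560: a bound on every finite horizon does NOT transfer to the
rescaled family uniformly in `ε` — for `f = id`, `f` is bounded on each `[0,T]`, yet `sup_{0<ε≤1} f(t/ε²) = ∞` already at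
`t = 1`. [cite: Mitrovic2024, Theorem 4 proof p.8 (l.560)] -/
theorem rescale_needs_uniformity :
    ∃ f : ℝ → ℝ, (∀ T : ℝ, ∃ M : ℝ, ∀ t ∈ Icc 0 T, f t ≤ M) ∧
      ∀ M : ℝ, ∃ ε ∈ Ioc (0 : ℝ) 1, M < f (1 / ε ^ 2) := by
  refine ⟨id, fun T => ⟨T, fun t ht => ht.2⟩, fun M => ?_⟩
  -- choose ε with 1/ε² > M: ε = 1/(|M|+2) works since 1/ε² = (|M|+2)² > M
  refine ⟨1 / (|M| + 2), ⟨by positivity, ?_⟩, ?_⟩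
  · rw [div_le_one (by positivity)]
    have := abs_nonneg M
    linarith
  · have hM : M ≤ |M| := le_abs_self M
    have h2 : (0 : ℝ) < |M| + 2 := by positivity
    simp only [id, one_div, inv_pow, inv_inv]
    nlinarith [abs_nonneg M]

/-- **Composition — Steps 1, 2, 4 give the headline** (Step 3 is inside `Route.limit`'s premise): for a datum, take the
route (Step 1); Step 2 turns (26) into (27) for every `ε ∈ (0,1]`, hence (by `bound27_uniform`) into the `ε`-, `t`-uniform
bound `(‖u₀‖_∞ + C₂)e^{C₁}`; the route's limit passage gives a bounded global Leray–Hopf solution; Step 4 makes it a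
Clay-(A)-sense solution. Pure logic; nothing asserted. [claim: Mitrovic2024, status: disputed] -/
theorem claim_of_steps (h1 : RouteExists) (h2 : Gronwall2627) (h4 : BoundedLerayHopfSmooth) : ClaimedTheorem := by
  intro u₀ hu₀
  obtain ⟨f, hR⟩ := h1 u₀ hu₀
  obtain ⟨C₁, C₂, hC₁, hC₂, h26⟩ := hR.young26
  have ha : 0 ≤ supNorm u₀ := by
    unfold supNorm
    exact Real.iSup_nonneg fun x => norm_nonneg _
  have hM : ∃ M : ℝ, ∀ ε ∈ Ioc (0 : ℝ) 1, ∀ t : ℝ, 0 ≤ t → f ε t ≤ M := by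
    refine ⟨(supNorm u₀ + C₂) * Real.exp C₁, fun ε hε t ht => ?_⟩
    have h27 : Bound27 ε C₁ C₂ (supNorm u₀) (f ε) :=
      h2 ε C₁ C₂ (supNorm u₀) (f ε) hε.1 hε.2 hC₁ hC₂ ha (hR.cont ε hε) (hR.nonneg ε hε) (h26 ε hε)
    exact bound27_uniform hε.1 hε.2 hC₁.le hC₂ ha h27 t ht
  obtain ⟨u, hLH, hbd⟩ := hR.limit hM
  exact h4 u₀ hu₀ u hLH hbd

/-- Steps 1, 2, 4 with the abstract's data class would give Clay (A) (`clay_of_claimedAbstract`); with the theorems' class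
they give (A) on compactly supported data (`claim_of_steps`). If every Step resisted refutation the skeleton would decide a
Clay-strength statement — the lead is told (CARD §3). [cite: FeffermanClay2006, statement (A), CMI offprint p. 2] -/
theorem clayA_restricted_of_steps (h1 : RouteExists) (h2 : Gronwall2627) (h4 : BoundedLerayHopfSmooth) :
    ∀ u₀ : EuclideanSpace ℝ (Fin 3) → EuclideanSpace ℝ (Fin 3), IsDatum u₀ → ClayVariants.clayR3.Solvable 1 0 u₀ :=
  claim_of_steps h1 h2 h4

end Literature.Claims.NS.Mitrovic2024

end

-- WHAT THIS IS NOT: not a claim about NS regularity or blow-up; not a claim about any author beyond the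
-- typed locator.
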